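import Literature.AlgebraicGeometry.Motives.ChernClassesProofs
import Mathlib.Algebra.Category.ModuleCat.Sheaf.PullbackFree
import Mathlib.AlgebraicGeometry.Restrict
import Mathlib.CategoryTheory.Filtered.Final
import Mathlib.Topology.Sheaves.SheafCondition.UniqueGluing
import HarnessLib

/-!
# Pull-back of finite locally free modules along a morphism of schemes

For a morphism of schemes `f : X ⟶ Y` and the inverse-image functor
`f^* = AlgebraicGeometry.Scheme.Modules.pullback f : Y.Modules ⥤ X.Modules` (Mathlib) we prove the
two facts that make the Grothendieck group of vector bundles a contravariant functor
(Fulton, *Intersection theory*, §15.1: "`f^* : K⁰X → K⁰Y`, taking `[E]` to `[f^*E]`"; SGA 6, Exp. IV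
§2; The Stacks project, Tag 01C8 for (i)):

* (i) `Literature.AlgebraicGeometry.Motives.IsFiniteLocallyFree.pullback`: if `E` is finite locally
  free (`Literature.AlgebraicGeometry.Motives.IsFiniteLocallyFree`, Stacks 01C6 (2)) then so is `f^* E`;
* (ii) `Literature.AlgebraicGeometry.KTheory.shortExact_map_pullback`: if `0 → E' → E → E'' → 0` is a
  short exact sequence of `𝒪_Y`-modules with `E''` finite locally free, then
  `0 → f^*E' → f^*E → f^*E'' → 0` is short exact (`f^*` is right exact as a left adjoint; it is
  exact on such sequences because they are locally split).

## Proof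

1. Restriction to an open `U ⊆ X` in three guises: Mathlib's `E.over U` (modules on the site of
   opens over `U`, used by `IsFiniteLocallyFree`), `Scheme.Modules.restrictFunctor U.ι` (good
   definitional behaviour on sections) and `Scheme.Modules.pullback U.ι`; they are identified by
   Mathlib's `Scheme.Modules.overFunctorEquiv` and `Scheme.Modules.restrictFunctorIsoPullback`, and
   all three send free modules to free modules (`nonempty_overEquivFreeIso`, Mathlib `mapFreeIso`,
   `pullbackObjFreeIso` — the latter needs the functor `U ↦ f⁻¹U` to be final, `final_opensMap`).
   Hence the restrict-form of finite local freeness (`IsFiniteLocallyFree.exists_free_iso_restrict`,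
   `isFiniteLocallyFree_of_restrict`).
2. Base change (`nonempty_pullbackRestrictIso`): `f^*` followed by restriction to `f⁻¹U` is restriction to
   `U` followed by `(f ∣_ U)^*`, from the pseudofunctoriality of `pullback` (Mathlib `pullbackComp`,
   `pullbackCongr`, `morphismRestrict_ι`). With 1 this proves (i).
3. Local splitting (`exists_isSplitMono_restrict_of_shortExact`): near every point of `Y` the
   epimorphism `E → E''` onto a finite free module has a section (lift the finitely many basis
   sections locally, `Literature.AlgebraicGeometry.Motives.Scheme.Modules.exists_app_eq_of_epi`), so
   `E'|_W → E|_W` is a split monomorphism (Mathlib `ShortComplex.Splitting.ofExactOfSection`).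
4. Monomorphisms of `𝒪_X`-modules are detected on an open cover (`mono_of_forall_mono_restrict`,
   sheaf locality), and `f^*(E' → E)` restricted to `f⁻¹W` is `(f ∣_ W)^*` of the split
   monomorphism of 3 (base change), hence a monomorphism; with right exactness this is (ii).

## Design

Everything is stated for Mathlib's `Scheme.Modules` and the tree's `IsFiniteLocallyFree`; no new
notion of vector bundle is introduced (`IsFiniteLocallyFree.isVectorBundle` of
`Motives/ChernClassesProofs` links to `IsVectorBundle`), and the file declares theorems only (the
auxiliary isomorphisms are recorded as `Nonempty` statements with the explicit Mathlib term in the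
proof). Deliberately not here: flatness of locally free modules, `Tor`, quasi-coherence.

## References

* W. Fulton, *Intersection theory*, 2nd ed., Springer (1998), §15.1. [Fulton1998]
* The Stacks project, Tags 01C6 (locally free modules), 01C8 (pull-back of locally free modules
  along a morphism of ringed spaces). [StacksProject]
* R. Hartshorne, *Algebraic Geometry* (1977), II.5 (inverse image of locally free sheaves,
  Ex. II.5.1, II.5.7). [Hartshorne1977]
-/

universe u

open CategoryTheory Limits AlgebraicGeometry
open Literature.AlgebraicGeometry.Motives

noncomputable section

namespace Literature.AlgebraicGeometry.KTheory

variable {X Y : Scheme.{u}}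

/-! ## Free modules under restriction and pull-back -/

/-- The functor `U ↦ f⁻¹U`, `Opens Y ⥤ Opens X`, underlying the morphism of ringed sites of a
morphism of schemes `f : X ⟶ Y`, is final (every `V ⊆ X` maps to `f⁻¹Y = X`, and `Opens Y` is
filtered). This is what Mathlib's `SheafOfModules.pullbackObjFreeIso` needs to identify `f^* 𝒪_Y^I`
with `𝒪_X^I`. Stated as a theorem (use `haveI := final_opensMap f`); this file deliberately
declares no definitions or instances. [folklore] -/
theorem final_opensMap (f : X ⟶ Y) : (TopologicalSpace.Opens.map f.base).Final := by
  apply Functor.final_of_exists_of_isFiltered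
  · intro V
    exact ⟨⊤, ⟨homOfLE le_top⟩⟩
  · intro V U s s'
    exact ⟨U, 𝟙 U, rfl⟩

/-- **`f^* 𝒪_Y^I ≅ 𝒪_X^I`**: the pull-back of a free module is free (Mathlib
`SheafOfModules.pullbackObjFreeIso`, applicable by `final_opensMap`; Hartshorne II.5, `f^*𝒪_Y = 𝒪_X`).
[folklore] -/
theorem nonempty_pullbackFreeIso (f : X ⟶ Y) (I : Type u) :
    Nonempty ((Scheme.Modules.pullback f).obj (SheafOfModules.free I) ≅ SheafOfModules.free I) :=
  haveI := final_opensMap f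
  ⟨SheafOfModules.pullbackObjFreeIso _ I⟩

/-- **Base change of module pull-back along an open immersion**: for `f : X ⟶ Y` and an open
`U ⊆ Y`, `f^*` followed by restriction to `f⁻¹U` is restriction to `U` followed by `(f ∣_ U)^*`,
as functors `Y.Modules ⥤ (f⁻¹U).Modules`; from `(f⁻¹U ↪ X) ≫ f = (f ∣_ U) ≫ (U ↪ Y)` (Mathlib
`morphismRestrict_ι`) and the pseudofunctoriality of pull-back (`Scheme.Modules.pullbackComp`).
The isomorphism is `pullbackComp _ _ ≪≫ pullbackCongr (morphismRestrict_ι f U).symm ≪≫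
(pullbackComp _ _).symm`; only its existence is recorded. [folklore] -/
theorem nonempty_pullbackRestrictIso (f : X ⟶ Y) (U : Y.Opens) :
    Nonempty (Scheme.Modules.pullback f ⋙ Scheme.Modules.pullback (f ⁻¹ᵁ U).ι ≅
      Scheme.Modules.pullback U.ι ⋙ Scheme.Modules.pullback (f ∣_ U)) :=
  ⟨Scheme.Modules.pullbackComp _ _ ≪≫ Scheme.Modules.pullbackCongr (morphismRestrict_ι f U).symm ≪≫
    (Scheme.Modules.pullbackComp _ _).symm⟩

/-- Mathlib's equivalence `Scheme.Modules.overEquiv U` (modules on the opens over `U` ≌ modules on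
the open subscheme `U`) sends `𝒪^I` to `𝒪_U^I` (it sends the unit to the unit,
`TopologicalSpace.Opens.sheafOfModulesEquivOverUnit`, and preserves coproducts; Mathlib
`SheafOfModules.mapFreeIso`). [folklore] -/
theorem nonempty_overEquivFreeIso (U : X.Opens) (I : Type u) :
    Nonempty (SheafOfModules.free (R := (U : Scheme.{u}).ringCatSheaf) I ≅
      (Scheme.Modules.overEquiv U).functor.obj (SheafOfModules.free I)) :=
  ⟨SheafOfModules.mapFreeIso (Scheme.Modules.overEquiv U).functor I
    (TopologicalSpace.Opens.sheafOfModulesEquivOverUnit (X := X.toTopCat) U X.ringCatSheaf).symm⟩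

/-- The inverse of `Scheme.Modules.overEquiv U` sends `𝒪_U^I` to `𝒪^I`
(`TopologicalSpace.Opens.sheafOfModulesEquivOverInverseUnit`). [folklore] -/
theorem nonempty_overEquivInverseFreeIso (U : X.Opens) (I : Type u) :
    Nonempty (SheafOfModules.free (R := X.ringCatSheaf.over U) I ≅
      (Scheme.Modules.overEquiv U).inverse.obj (SheafOfModules.free I)) :=
  ⟨SheafOfModules.mapFreeIso (Scheme.Modules.overEquiv U).inverse I
    (TopologicalSpace.Opens.sheafOfModulesEquivOverInverseUnit (X := X.toTopCat) U
      X.ringCatSheaf).symm⟩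

/-- From a trivialisation `𝒪^I ≅ E.over U` on the opens over `U` to a trivialisation
`𝒪_U^I ≅ E|_U` of the restriction along the open immersion `U ↪ X`
(Mathlib `Scheme.Modules.overFunctorEquiv`). [folklore] -/
theorem nonempty_restrictIso_of_overIso {E : X.Modules} {U : X.Opens} {I : Type u}
    (e : SheafOfModules.free I ≅ E.over U) :
    Nonempty (SheafOfModules.free (R := (U : Scheme.{u}).ringCatSheaf) I ≅
      (Scheme.Modules.restrictFunctor U.ι).obj E) := by
  obtain ⟨e₀⟩ := nonempty_overEquivFreeIso U I
  exact ⟨e₀ ≪≫ (Scheme.Modules.overEquiv U).functor.mapIso e ≪≫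
    (Scheme.Modules.overFunctorEquiv U).app E⟩

/-- From a trivialisation `𝒪_U^I ≅ E|_U` of the restriction along `U ↪ X` to a trivialisation
`𝒪^I ≅ E.over U` on the opens over `U`. [folklore] -/
theorem nonempty_overIso_of_restrictIso {E : X.Modules} {U : X.Opens} {I : Type u}
    (e : SheafOfModules.free (R := (U : Scheme.{u}).ringCatSheaf) I ≅
      (Scheme.Modules.restrictFunctor U.ι).obj E) :
    Nonempty (SheafOfModules.free I ≅ E.over U) := by
  obtain ⟨e₀⟩ := nonempty_overEquivInverseFreeIso U I
  exact ⟨e₀ ≪≫ (Scheme.Modules.overEquiv U).inverse.mapIso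
      (e ≪≫ ((Scheme.Modules.overFunctorEquiv U).app E).symm) ≪≫
    ((Scheme.Modules.overEquiv U).unitIso.app (E.over U)).symm⟩

/-- **Restrict-form of finite local freeness**: a finite locally free `𝒪_X`-module is, near every
point, free of finite rank after restriction along an open immersion `U ↪ X`. [folklore] -/
theorem _root_.Literature.AlgebraicGeometry.Motives.IsFiniteLocallyFree.exists_free_iso_restrict
    {E : X.Modules} (hE : IsFiniteLocallyFree E) (x : X) :
    ∃ U : X.Opens, x ∈ U ∧ ∃ I : Type u, Finite I ∧
      Nonempty (SheafOfModules.free (R := (U : Scheme.{u}).ringCatSheaf) I ≅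
        (Scheme.Modules.restrictFunctor U.ι).obj E) := by
  obtain ⟨U, hxU, I, hI, ⟨e⟩⟩ := hE x
  exact ⟨U, hxU, I, hI, nonempty_restrictIso_of_overIso e⟩

/-- Conversely, local trivialisations of the restrictions along open immersions give finite local
freeness. [folklore] -/
theorem isFiniteLocallyFree_of_restrict {E : X.Modules}
    (h : ∀ x : X, ∃ U : X.Opens, x ∈ U ∧ ∃ I : Type u, Finite I ∧
      Nonempty (SheafOfModules.free (R := (U : Scheme.{u}).ringCatSheaf) I ≅
        (Scheme.Modules.restrictFunctor U.ι).obj E)) :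
    IsFiniteLocallyFree E := by
  intro x
  obtain ⟨U, hxU, I, hI, ⟨e⟩⟩ := h x
  exact ⟨U, hxU, I, hI, nonempty_overIso_of_restrictIso e⟩

/-! ## (i) Pull-back of a finite locally free module is finite locally free -/

/-- The restriction of `f^*E` to `f⁻¹U` is `(f ∣_ U)^*` of the restriction of `E` to `U`
(`nonempty_pullbackRestrictIso` in `restrictFunctor` form, via Mathlib
`Scheme.Modules.restrictFunctorIsoPullback`). [folklore] -/
theorem nonempty_restrictPullbackIso (f : X ⟶ Y) (U : Y.Opens) (E : Y.Modules) :
    Nonempty ((Scheme.Modules.restrictFunctor (f ⁻¹ᵁ U).ι).obj ((Scheme.Modules.pullback f).obj E) ≅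
      (Scheme.Modules.pullback (f ∣_ U)).obj ((Scheme.Modules.restrictFunctor U.ι).obj E)) := by
  obtain ⟨i⟩ := nonempty_pullbackRestrictIso f U
  exact ⟨(Scheme.Modules.restrictFunctorIsoPullback (f ⁻¹ᵁ U).ι).app _ ≪≫ i.app E ≪≫
    (Scheme.Modules.pullback (f ∣_ U)).mapIso
      ((Scheme.Modules.restrictFunctorIsoPullback U.ι).app E).symm⟩

/-- **(i) The pull-back of a finite locally free module is finite locally free**
(Stacks, Tag 01C8; Hartshorne II Ex. 5.1/5.7: `f^*` of a locally free sheaf of finite rank is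
locally free of the same rank): if `E|_U ≅ 𝒪_U^I` near `f x` then
`(f^*E)|_{f⁻¹U} ≅ (f ∣_ U)^*(E|_U) ≅ (f ∣_ U)^* 𝒪_U^I ≅ 𝒪_{f⁻¹U}^I`. Deliberate dot-notation
extension of `Literature.AlgebraicGeometry.Motives.IsFiniteLocallyFree` from the `KTheory` directory.
[cite: StacksProject, Tag 01C8] -/
theorem _root_.Literature.AlgebraicGeometry.Motives.IsFiniteLocallyFree.pullback {E : Y.Modules}
    (hE : IsFiniteLocallyFree E) (f : X ⟶ Y) :
    IsFiniteLocallyFree ((Scheme.Modules.pullback f).obj E) := by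
  refine isFiniteLocallyFree_of_restrict fun x ↦ ?_
  obtain ⟨U, hxU, I, hI, ⟨e⟩⟩ := hE.exists_free_iso_restrict (f.base x)
  obtain ⟨e₁⟩ := nonempty_pullbackFreeIso (f ∣_ U) I
  obtain ⟨e₂⟩ := nonempty_restrictPullbackIso f U E
  exact ⟨f ⁻¹ᵁ U, hxU, I, hI, ⟨e₁.symm ≪≫ (Scheme.Modules.pullback (f ∣_ U)).mapIso e ≪≫ e₂.symm⟩⟩

/-! ## Transport of (split) monomorphisms -/

section Transport

variable {C D : Type*} [Category C] [Category D]

-- A functor takes split monomorphisms to split monomorphisms: this is Mathlib's instance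
-- `CategoryTheory.instIsSplitMonoMap` (`IsSplitMono f → IsSplitMono (F.map f)`), used below.

/-- Split monomorphisms `F φ` transport along a natural isomorphism `F ≅ G`. [folklore] -/
theorem isSplitMono_map_of_natIso {F G : C ⥤ D} (i : F ≅ G) {A B : C} (φ : A ⟶ B)
    (h : IsSplitMono (F.map φ)) : IsSplitMono (G.map φ) := by
  obtain ⟨sm⟩ := h.exists_splitMono
  refine ⟨⟨⟨i.inv.app B ≫ sm.retraction ≫ i.hom.app A, ?_⟩⟩⟩
  have hn : G.map φ ≫ i.inv.app B = i.inv.app A ≫ F.map φ := i.inv.naturality φ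
  rw [reassoc_of% hn, sm.id_assoc, Iso.inv_hom_id_app]

/-- Monomorphisms `F φ` transport along a natural isomorphism `F ≅ G`. [folklore] -/
theorem mono_map_of_natIso {F G : C ⥤ D} (i : F ≅ G) {A B : C} (φ : A ⟶ B)
    (h : Mono (F.map φ)) : Mono (G.map φ) := by
  have hn : G.map φ = i.inv.app A ≫ F.map φ ≫ i.hom.app B := by
    rw [← Category.assoc, ← i.inv.naturality φ, Category.assoc, Iso.inv_hom_id_app,
      Category.comp_id]
  rw [hn]
  infer_instance

end Transport

/-! ## Local splitting of a short exact sequence with finite locally free cokernel -/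

/-- **Local splitting.** Let `0 → E' → E → E'' → 0` be a short exact sequence of `𝒪_Y`-modules
with `E''` finite locally free. Then every point of `Y` has an open neighbourhood `W` such that
`E'|_W → E|_W` (restriction to the opens over `W`) is a split monomorphism: if `E''|_U ≅ 𝒪^K` with
`K` finite, lift the `K` basis sections through the epimorphism `E → E''` on neighbourhoods `V_k`
(`Literature.AlgebraicGeometry.Motives.Scheme.Modules.exists_app_eq_of_epi`), put `W = U ∩ ⋂ V_k`;
the lifts define a section of `E|_W → E''|_W ≅ 𝒪^K`, whence a splitting (Mathlib
`ShortComplex.Splitting.ofExactOfSection`; restriction is exact,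
`Literature.AlgebraicGeometry.Motives.Scheme.Modules.shortExact_map_overFunctor`). This is the
sheaf form of "a surjection onto a finite free module splits", following the tree's
`isFiniteLocallyFree_of_shortExact` (cf. Hartshorne II Ex. 5.7 (b)). [folklore] -/
theorem exists_isSplitMono_over_of_shortExact {S : ShortComplex Y.Modules} (hS : S.ShortExact)
    (h₃ : IsFiniteLocallyFree S.X₃) (y : Y) :
    ∃ W : Y.Opens, y ∈ W ∧ IsSplitMono ((Scheme.Modules.overFunctor W).map S.f) := by
  obtain ⟨U₃, hy₃, K, hK, ⟨e₃⟩⟩ := h₃ y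
  haveI : Epi S.g := hS.epi_g
  haveI := hK
  -- the basis sections of `S.X₃` over `U₃` and their local lifts through the epimorphism `S.g`
  let n : K → Γ(S.X₃, U₃) := fun k ↦
    Scheme.Modules.overSectionsEquiv S.X₃ U₃ ((S.X₃.over U₃).freeHomEquiv e₃.hom k)
  choose V hV hyV s hs using fun k ↦ Scheme.Modules.exists_app_eq_of_epi S.g U₃ (n k) y hy₃
  let W : Y.Opens := U₃ ⊓ ⨅ k, V k
  have hyW : y ∈ W := by
    refine ⟨hy₃, ?_⟩
    rw [TopologicalSpace.Opens.coe_iInf]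
    exact Set.mem_iInter.mpr hyV
  have hW₃ : W ≤ U₃ := inf_le_left
  have hWV : ∀ k, W ≤ V k := fun k ↦ inf_le_right.trans (iInf_le _ k)
  refine ⟨W, hyW, ?_⟩
  -- the restricted lifts map to the basis sections of the restricted trivialisation of `S.X₃`
  have key : ∀ k, Scheme.Modules.overSectionsEquiv S.X₃ W (SheafOfModules.sectionsMap
      ((Scheme.Modules.overFunctor W).map S.g) ((Scheme.Modules.overSectionsEquiv S.X₂ W).symm
        (S.X₂.presheaf.map (homOfLE (hWV k)).op (s k)))) =
      Scheme.Modules.overSectionsEquiv S.X₃ W ((S.X₃.over W).freeHomEquiv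
        (SheafOfModules.restrictTrivialisation (R := Y.ringCatSheaf) (homOfLE hW₃) e₃).hom k) := by
    intro k
    rw [Scheme.Modules.overSectionsEquiv_sectionsMap, Equiv.apply_symm_apply,
      Scheme.Modules.overSectionsEquiv_restrictTrivialisation, Scheme.Modules.Hom.app_map_apply,
      hs, ← ConcreteCategory.comp_apply, ← Functor.map_comp]
    rfl
  -- the restricted trivialisation `e₃W : 𝒪^K ≅ S.X₃|_W` and the lifts `σ : 𝒪^K ⟶ S.X₂|_W`,
  -- with `σ ≫ g|_W = e₃W`
  let e₃W : SheafOfModules.free K ≅ S.X₃.over W :=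
    SheafOfModules.restrictTrivialisation (R := Y.ringCatSheaf) (homOfLE hW₃) e₃
  let t : K → (S.X₂.over W).sections := fun k ↦
    (Scheme.Modules.overSectionsEquiv S.X₂ W).symm (S.X₂.presheaf.map (homOfLE (hWV k)).op (s k))
  let σ : SheafOfModules.free K ⟶ S.X₂.over W := (S.X₂.over W).freeHomEquiv.symm t
  have hσ : σ ≫ (Scheme.Modules.overFunctor W).map S.g = e₃W.hom := by
    change (S.X₂.over W).freeHomEquiv.symm t ≫ _ = _
    rw [SheafOfModules.freeHomEquiv_symm_comp, Equiv.symm_apply_eq]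
    funext k
    exact (Scheme.Modules.overSectionsEquiv S.X₃ W).injective (key k)
  have hSW := Scheme.Modules.shortExact_map_overFunctor hS W
  have hsec : (e₃W.inv ≫ σ) ≫ (S.map (Scheme.Modules.overFunctor W)).g = 𝟙 _ := by
    change (e₃W.inv ≫ σ) ≫ (Scheme.Modules.overFunctor W).map S.g = 𝟙 _
    rw [Category.assoc, hσ]
    exact e₃W.inv_hom_id
  exact (ShortComplex.Splitting.ofExactOfSection _ hSW.exact (e₃W.inv ≫ σ) hsec
    hSW.mono_f).isSplitMono_f

/-- Local splitting in `restrictFunctor` form: near every point, `E'|_W → E|_W` (restriction along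
the open immersion `W ↪ Y`) is a split monomorphism (transport of
`exists_isSplitMono_over_of_shortExact` along Mathlib's `Scheme.Modules.overFunctorEquiv`).
[folklore] -/
theorem exists_isSplitMono_restrict_of_shortExact {S : ShortComplex Y.Modules} (hS : S.ShortExact)
    (h₃ : IsFiniteLocallyFree S.X₃) (y : Y) :
    ∃ W : Y.Opens, y ∈ W ∧ IsSplitMono ((Scheme.Modules.restrictFunctor W.ι).map S.f) := by
  obtain ⟨W, hyW, hW⟩ := exists_isSplitMono_over_of_shortExact hS h₃ y
  refine ⟨W, hyW, ?_⟩
  have h₁ : IsSplitMono ((Scheme.Modules.overFunctor W ⋙ (Scheme.Modules.overEquiv W).functor).map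
      S.f) := instIsSplitMonoMap ((Scheme.Modules.overFunctor W).map S.f)
    (Scheme.Modules.overEquiv W).functor
  have h₂ : IsSplitMono ((SheafOfModules.overFunctor Y.ringCatSheaf W ⋙
      (Scheme.Modules.overEquiv W).functor).map S.f) := h₁
  exact isSplitMono_map_of_natIso (Scheme.Modules.overFunctorEquiv W) S.f h₂

/-! ## Monomorphisms are local -/

/-- A monomorphism of `𝒪_X`-modules is injective on sections over every open (the forgetful
functor to presheaves of modules is a right adjoint, so preserves monomorphisms, and monomorphisms
of presheaves of modules are injective, Mathlib `PresheafOfModules.injective_of_mono`).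
[folklore] -/
theorem app_injective_of_mono {M N : X.Modules} (φ : M ⟶ N) [Mono φ] (U : X.Opens) :
    Function.Injective (φ.app U) := by
  haveI : Mono ((Scheme.Modules.toPresheafOfModules X).map φ) := inferInstance
  exact PresheafOfModules.injective_of_mono ((Scheme.Modules.toPresheafOfModules X).map φ)
    (Opposite.op U)

/-- A morphism of `𝒪_X`-modules which is injective on sections over every open is a
monomorphism. [folklore] -/
theorem mono_of_app_injective {M N : X.Modules} (φ : M ⟶ N)
    (h : ∀ U : X.Opens, Function.Injective (φ.app U)) : Mono φ where
  right_cancellation g₁ g₂ hg := by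
    refine Scheme.Modules.hom_ext _ _ fun U ↦ ?_
    ext k
    apply h U
    change (g₁ ≫ φ).app U k = (g₂ ≫ φ).app U k
    rw [hg]

/-- **Monomorphisms of `𝒪_X`-modules are detected on an open cover**: if every point has an open
neighbourhood `W` such that `φ|_W` (restriction along `W ↪ X`) is a monomorphism, then `φ` is a
monomorphism. Injectivity on sections over `U` is checked on the cover `U ∩ W_x` by the locality
axiom of the sheaf `M` (Mathlib `TopCat.Sheaf.eq_of_locally_eq'`), the sections of `M|_W` over
`W⁻¹U` being those of `M` over `U ∩ W` (Mathlib `Scheme.Modules.restrict_obj`). [folklore] -/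
theorem mono_of_forall_mono_restrict {M N : X.Modules} (φ : M ⟶ N)
    (h : ∀ x : X, ∃ W : X.Opens, x ∈ W ∧ Mono ((Scheme.Modules.restrictFunctor W.ι).map φ)) :
    Mono φ := by
  choose W hxW hW using h
  refine mono_of_app_injective φ fun U s t hst ↦ ?_
  -- the cover of `U` by the `U ∩ W_x`, written as images of preimages along `W_x ↪ X`
  let O : U → X.Opens := fun x ↦ (W x.1).ι ''ᵁ ((W x.1).ι ⁻¹ᵁ U)
  have hO : ∀ x : U, O x ≤ U := fun x ↦ (W x.1).ι.image_preimage_le U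
  have hcov : U ≤ iSup O := by
    intro x hx
    refine TopologicalSpace.Opens.mem_iSup.mpr ⟨⟨x, hx⟩, ?_⟩
    exact ⟨⟨x, hxW x⟩, hx, rfl⟩
  refine TopCat.Sheaf.eq_of_locally_eq' (⟨M.presheaf, M.isSheaf⟩ : TopCat.Sheaf Ab X.toTopCat) O U
    (fun x ↦ homOfLE (hO x)) hcov s t fun x ↦ ?_
  -- injectivity of `φ` over `O x`, from `Mono (φ|_{W x})` at the open `(W x)⁻¹ U`
  haveI := hW x.1
  have hinj : Function.Injective (φ.app (O x)) :=
    app_injective_of_mono ((Scheme.Modules.restrictFunctor (W x.1).ι).map φ) ((W x.1).ι ⁻¹ᵁ U)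
  apply hinj
  change φ.app (O x) (M.presheaf.map (homOfLE (hO x)).op s) =
    φ.app (O x) (M.presheaf.map (homOfLE (hO x)).op t)
  rw [Scheme.Modules.Hom.app_map_apply, Scheme.Modules.Hom.app_map_apply, hst]

/-! ## (ii) Pull-back of a short exact sequence of vector bundles is short exact -/

/-- `f^*` is right exact: for a short exact sequence `0 → E' → E → E'' → 0` of `𝒪_Y`-modules,
`f^*E' → f^*E → f^*E'' → 0` is exact (`f^*` is a left adjoint, Mathlib
`Functor.preservesFiniteColimits_iff_forall_exact_map_and_epi`). [folklore] -/
theorem exact_map_pullback_and_epi (f : X ⟶ Y) {S : ShortComplex Y.Modules} (hS : S.ShortExact) :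
    (S.map (Scheme.Modules.pullback f)).Exact ∧ Epi ((Scheme.Modules.pullback f).map S.g) :=
  (Functor.preservesFiniteColimits_iff_forall_exact_map_and_epi _).mp inferInstance S hS

/-- **(ii) `f^*` is exact on short exact sequences with finite locally free cokernel**: if
`0 → E' → E → E'' → 0` is a short exact sequence of `𝒪_Y`-modules with `E''` finite locally free
(in particular a short exact sequence of vector bundles), then `0 → f^*E' → f^*E → f^*E'' → 0` is
short exact (SGA 6 IV 2.7 / Fulton §15.1: pull-back of an exact sequence of vector bundles is
exact, which is what makes `f^* : K⁰Y → K⁰X` well defined). Right exactness is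
`exact_map_pullback_and_epi`; `f^*E' → f^*E` is a monomorphism because locally on `Y` the sequence
splits (`exists_isSplitMono_restrict_of_shortExact`), the restriction of `f^*(E' → E)` to `f⁻¹W`
is `(f ∣_ W)^*` of the split monomorphism `E'|_W → E|_W` (`nonempty_pullbackRestrictIso`), and
monomorphisms are local (`mono_of_forall_mono_restrict`). [cite: Fulton1998, §15.1] -/
theorem shortExact_map_pullback (f : X ⟶ Y) {S : ShortComplex Y.Modules} (hS : S.ShortExact)
    (h₃ : IsFiniteLocallyFree S.X₃) : (S.map (Scheme.Modules.pullback f)).ShortExact := by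
  obtain ⟨hex, hepi⟩ := exact_map_pullback_and_epi f hS
  haveI : Epi (S.map (Scheme.Modules.pullback f)).g := hepi
  haveI : Mono (S.map (Scheme.Modules.pullback f)).f := by
    change Mono ((Scheme.Modules.pullback f).map S.f)
    refine mono_of_forall_mono_restrict _ fun x ↦ ?_
    obtain ⟨W, hxW, hW⟩ := exists_isSplitMono_restrict_of_shortExact hS h₃ (f.base x)
    refine ⟨f ⁻¹ᵁ W, hxW, ?_⟩
    -- `S.f|_W` split mono ⟹ `(W ↪ Y)^* S.f` split mono ⟹ `(f ∣_ W)^* (W ↪ Y)^* S.f` split mono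
    have h₁ : IsSplitMono ((Scheme.Modules.pullback W.ι).map S.f) :=
      isSplitMono_map_of_natIso (Scheme.Modules.restrictFunctorIsoPullback W.ι) S.f hW
    have h₂ : IsSplitMono
        ((Scheme.Modules.pullback W.ι ⋙ Scheme.Modules.pullback (f ∣_ W)).map S.f) :=
      instIsSplitMonoMap ((Scheme.Modules.pullback W.ι).map S.f) (Scheme.Modules.pullback (f ∣_ W))
    -- base change back to `(f⁻¹W ↪ X)^* f^* S.f`, then to the restriction functor
    obtain ⟨i⟩ := nonempty_pullbackRestrictIso f W
    have h₃ : IsSplitMono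
        ((Scheme.Modules.pullback f ⋙ Scheme.Modules.pullback (f ⁻¹ᵁ W).ι).map S.f) :=
      isSplitMono_map_of_natIso i.symm S.f h₂
    have h₄ : Mono ((Scheme.Modules.pullback (f ⁻¹ᵁ W).ι).map
        ((Scheme.Modules.pullback f).map S.f)) := h₃.mono
    exact mono_map_of_natIso (Scheme.Modules.restrictFunctorIsoPullback (f ⁻¹ᵁ W).ι).symm _ h₄
  exact { exact := hex }

/-- (ii) for the tree's vector bundles of bounded rank: the pull-back of a short exact sequence
whose cokernel has rank `≤ r` (`Literature.AlgebraicGeometry.Motives.HasRankLE`) is short exact.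
[folklore] -/
theorem shortExact_map_pullback_of_hasRankLE (f : X ⟶ Y) {S : ShortComplex Y.Modules}
    (hS : S.ShortExact) {r : ℕ} (h₃ : HasRankLE S.X₃ r) :
    (S.map (Scheme.Modules.pullback f)).ShortExact :=
  shortExact_map_pullback f hS h₃.isFiniteLocallyFree

end Literature.AlgebraicGeometry.KTheory

end
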